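import Summits.Ventures.YMGap.RobustBall.IsingBallB2
import HarnessLib

/-!
# RobustBall/IsingBallD3 — the Ising model on the radius-2 ball `B₂` of `ℤ²` (13 sites) EXACTLY at `tanh β = 6/19`: the core sum of the third rung
# of the Simon–Lieb ladder for the centre-blind window in `d = 3` (two-dimensional layers)

HONEST FRAMING: venture file of the cell `pub-ymgap` (QuantumFields programme), track Y2 ROBUST-BALL / DS seat ds-4 (g10).  A finite computation
about the classical nearest-neighbour Ising model (free boundary condition, zero field) on ONE explicit finite graph with 13 vertices; nothing about
`SU(2)`, the torus or the continuum is in this file.  It is the `d = 3` twin of `IsingBallB2` (the 25-site ball of `ℤ³`, `d = 4`): for `d = 3` the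
layers of the centre-projected `ℤ₂` theory are two-dimensional, and the Simon–Lieb set of rung 3 is the 13-site ball of `ℤ²` (centre, four middle
sites `±e_k`, four axis sites `±2e_k`, four corners `±e_0 ± e_1`), whose core (centre + middles) has `2⁵ = 32` configurations.

WHAT.  `BallD3.V`, `BallD3.graph` (16 edges, kernel-decided), the high-temperature reduction `BallD3.sum_cfg_eq_coreSum` (the spin bookkeeping `sp`, `sum_units`, `exp_mul_sign` is imported from `IsingBallB2`) (axis spins `∑_u(1+tmu) = 2`,
corners `∑_u(1+tm₀u)(1+tm₁u) = 2(1+t²m₀m₁)`), and at `β₃ = artanh(6/19) = 0.326962…` (`e^{2β₃} = 25/13`) the EXACT number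
`∑_m ⟨σ_0 σ_m⟩_{B₂;β₃} = 111425521874979072 / 73973434400755232 = 1.5062911…` (`BallD3.sum_isingTwoPoint_centre_mid_eq`; kernel integer arithmetic;
two offline lineages agree).  The boundary bound, the layer transport and the window `AreaLawCentreBlind 2 3 β` for `tanh(2|β|) ≤ 6/19` are in
`IsingBallD3Bound` / `IsingBallD3Embed` / `IsingBallD3Layer` / `CentreBlindBallWindowD3`.

References: B. Simon, Comm. Math. Phys. 77 (1980) 111; E. Lieb, Comm. Math. Phys. 77 (1980) 127; S. Friedli, Y. Velenik (2017) §3.7.3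
[FriedliVelenik2017].
-/

noncomputable section

open Finset
open Literature.Probability.LatticeModels

namespace Summit.Ventures.YMGap.RobustBall

namespace BallD3

/-! ### The ball `B₂ ⊂ ℤ²` as an explicit graph -/

/-- The 13 vertices of the `ℓ¹`-ball of radius `2` in `ℤ²`: the centre, the middle sites `±e_k`, the axis sites `±2e_k` (`k : Fin 2`) and the four
corners `±e_0 ± e_1`. [folklore] -/
inductive V : Type
  | centre : V
  | mid (k : Fin 2) (s : Bool) : V
  | axis (k : Fin 2) (s : Bool) : V
  | corner (s s' : Bool) : V
  deriving DecidableEq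

namespace V

/-- `V` as a sum of products (for enumeration). [folklore] -/
def equivSum : V ≃ (Unit ⊕ (Fin 2 × Bool)) ⊕ ((Fin 2 × Bool) ⊕ (Bool × Bool)) where
  toFun
    | centre => Sum.inl (Sum.inl ())
    | mid k s => Sum.inl (Sum.inr (k, s))
    | axis k s => Sum.inr (Sum.inl (k, s))
    | corner s s' => Sum.inr (Sum.inr (s, s'))
  invFun
    | Sum.inl (Sum.inl ()) => centre
    | Sum.inl (Sum.inr (k, s)) => mid k s
    | Sum.inr (Sum.inl (k, s)) => axis k s
    | Sum.inr (Sum.inr (s, s')) => corner s s'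
  left_inv p := by cases p <;> rfl
  right_inv q := by rcases q with (⟨⟨⟩⟩ | ⟨k, s⟩) | (⟨k, s⟩ | ⟨s, s'⟩) <;> rfl

/-- `V` is finite (13 elements). [folklore] -/
instance : Fintype V := Fintype.ofEquiv _ equivSum.symm

/-- The adjacency of the induced subgraph of `ℤ²` on the ball: centre–middle, middle–axis (same direction and sign), middle–corner
(`±e_0 ± e_1 ∼ ±e_0` and `∼ ±e_1`). [folklore] -/
def adj : V → V → Prop
  | centre, mid _ _ => True
  | mid _ _, centre => True
  | mid k s, axis k' s' => k = k' ∧ s = s'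
  | axis k' s', mid k s => k = k' ∧ s = s'
  | mid k s, corner t t' => (k = 0 ∧ s = t) ∨ (k = 1 ∧ s = t')
  | corner t t', mid k s => (k = 0 ∧ s = t) ∨ (k = 1 ∧ s = t')
  | _, _ => False

/-- `adj` is symmetric. [folklore] -/
theorem adj_symm {p q : V} (h : adj p q) : adj q p := by
  cases p <;> cases q <;> simp only [adj] at h ⊢ <;> assumption

/-- `adj` is irreflexive. [folklore] -/
theorem adj_irrefl (p : V) : ¬adj p p := by
  cases p <;> simp [adj]

/-- `adj` is decidable. [folklore] -/
instance : DecidableRel adj := fun p q => by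
  cases p <;> cases q <;> simp only [adj] <;> infer_instance

end V

open V

/-- **The ball graph `B₂ ⊂ ℤ²`**. [folklore] -/
def graph : SimpleGraph V where
  Adj := V.adj
  symm := ⟨fun _ _ h => V.adj_symm h⟩
  loopless := ⟨fun p => V.adj_irrefl p⟩

/-- Adjacency of `graph` is decidable. [folklore] -/
instance : DecidableRel graph.Adj := fun p q => inferInstanceAs (Decidable (V.adj p q))

/-- Adjacency of `graph` is `V.adj`. [folklore] -/
theorem graph_adj (p q : V) : graph.Adj p q ↔ V.adj p q := Iff.rfl

/-- The centre–middle edges. [folklore] -/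
def edgesCM : Finset (Sym2 V) := univ.image fun ks : Fin 2 × Bool => s(centre, mid ks.1 ks.2)

/-- The middle–axis edges. [folklore] -/
def edgesMA : Finset (Sym2 V) := univ.image fun ks : Fin 2 × Bool => s(mid ks.1 ks.2, axis ks.1 ks.2)

/-- The corner–(direction 0) edges. [folklore] -/
def edgesC1 : Finset (Sym2 V) := univ.image fun c : Bool × Bool => s(corner c.1 c.2, mid 0 c.1)

/-- The corner–(direction 1) edges. [folklore] -/
def edgesC2 : Finset (Sym2 V) := univ.image fun c : Bool × Bool => s(corner c.1 c.2, mid 1 c.2)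

/-- **The 16 edges of `B₂ ⊂ ℤ²`** (kernel-decided). [folklore] -/
theorem edgeFinset_graph : graph.edgeFinset = edgesCM ∪ edgesMA ∪ edgesC1 ∪ edgesC2 := by decide

/-- A product over the edges splits into the three families. [folklore] -/
theorem prod_edgeFinset_graph (f : Sym2 V → ℝ) :
    ∏ e ∈ graph.edgeFinset, f e =
      (∏ ks : Fin 2 × Bool, f s(centre, mid ks.1 ks.2)) * (∏ ks : Fin 2 × Bool, f s(mid ks.1 ks.2, axis ks.1 ks.2)) *
        ∏ c : Bool × Bool, (f s(corner c.1 c.2, mid 0 c.1) * f s(corner c.1 c.2, mid 1 c.2)) := by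
  have hd1 : Disjoint edgesCM edgesMA := by decide
  have hd2 : Disjoint (edgesCM ∪ edgesMA) edgesC1 := by decide
  have hd3 : Disjoint (edgesCM ∪ edgesMA ∪ edgesC1) edgesC2 := by decide
  rw [edgeFinset_graph, prod_union hd3, prod_union hd2, prod_union hd1]
  unfold edgesCM edgesMA edgesC1 edgesC2
  rw [prod_image (by decide), prod_image (by decide), prod_image (by decide), prod_image (by decide), prod_mul_distrib]
  ring

/-! ### Core configurations and the reduced weight -/

/-- A core configuration: the centre spin and the four middle spins `(σ_0; m_{0+}, m_{0−}, m_{1+}, m_{1−})`. [folklore] -/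
abbrev Cfg : Type := ℤˣ × ℤˣ × ℤˣ × ℤˣ × ℤˣ

/-- The middle spin `m_{k,s}` of a core configuration. [folklore] -/
def Cfg.m (x : Cfg) (k : Fin 2) (s : Bool) : ℤˣ :=
  if s then ![x.2.1, x.2.2.2.1] k else ![x.2.2.1, x.2.2.2.2] k

/-- **The reduced core weight at `tanh β = 6/19`, cleared of denominators**:
`W(x) = ∏_{k,s} (19 + 6 σ_0 m_{k,s}) · ∏_{corners} (361 + 36 m_{0,s} m_{1,s'})` (an integer). [folklore] -/
def coreW (x : Cfg) : ℝ :=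
  (∏ ks : Fin 2 × Bool, (19 + 6 * sp x.1 * sp (x.m ks.1 ks.2))) * ∏ c : Bool × Bool, (361 + 36 * sp (x.m 0 c.1) * sp (x.m 1 c.2))

/-- The core observable `σ_0 · (sum of the four middle spins)`. [folklore] -/
def coreObs (x : Cfg) : ℝ := sp x.1 * ∑ ks : Fin 2 × Bool, sp (x.m ks.1 ks.2)

/-- **KERNEL ARITHMETIC, denominator**: `∑_x W(x) = 73973434400755232`. [folklore] -/
theorem coreSum_one : ∑ x : Cfg, coreW x = 73973434400755232 := by
  simp only [coreW, Fintype.prod_prod_type, Fin.prod_univ_two, Fintype.prod_bool, Cfg.m, if_true, if_false, Bool.false_eq_true,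
    Matrix.cons_val_zero, Matrix.cons_val_one, Fintype.sum_prod_type, sum_units, sp_one, sp_neg_one]
  norm_num

/-- **KERNEL ARITHMETIC, numerator**: `∑_x σ_0 M(x) W(x) = 111425521874979072`. [folklore] -/
theorem coreSum_obs : ∑ x : Cfg, coreObs x * coreW x = 111425521874979072 := by
  simp only [coreW, coreObs, Fintype.prod_prod_type, Fin.prod_univ_two, Fintype.prod_bool, Cfg.m, if_true, if_false, Bool.false_eq_true,
    Matrix.cons_val_zero, Matrix.cons_val_one, Fintype.sum_prod_type, Fin.sum_univ_two, Fintype.sum_bool, sum_units, sp_one, sp_neg_one]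
  norm_num

/-! ### Splitting a configuration into core and boundary spins -/

/-- The configuration space of the ball as (core 5-tuple) × (axis spins) × (corner spins). [folklore] -/
def cfgEquiv : SpinConfig V ≃ Cfg × ((Fin 2 × Bool → ℤˣ) × (Bool × Bool → ℤˣ)) where
  toFun σ := ((σ centre, σ (mid 0 true), σ (mid 0 false), σ (mid 1 true), σ (mid 1 false)),
    (fun ks => σ (axis ks.1 ks.2), fun c => σ (corner c.1 c.2)))
  invFun y p := match p with
    | centre => y.1.1
    | mid k s => y.1.m k s
    | axis k s => y.2.1 (k, s)
    | corner s s' => y.2.2 (s, s')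
  left_inv σ := by
    funext p
    cases p with
    | centre => rfl
    | mid k s => fin_cases k <;> cases s <;> rfl
    | axis k s => rfl
    | corner s s' => rfl
  right_inv y := by
    obtain ⟨⟨c, m0p, m0m, m1p, m1m⟩, fa, fc⟩ := y
    rfl

/-- Spins of the split configuration: centre. [folklore] -/
@[simp] theorem cfgEquiv_symm_centre (y : Cfg × ((Fin 2 × Bool → ℤˣ) × (Bool × Bool → ℤˣ))) : cfgEquiv.symm y centre = y.1.1 := rfl

/-- Spins of the split configuration: middle sites. [folklore] -/
@[simp] theorem cfgEquiv_symm_mid (y : Cfg × ((Fin 2 × Bool → ℤˣ) × (Bool × Bool → ℤˣ))) (k : Fin 2) (s : Bool) :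
    cfgEquiv.symm y (mid k s) = y.1.m k s := rfl

/-- Spins of the split configuration: axis sites. [folklore] -/
@[simp] theorem cfgEquiv_symm_axis (y : Cfg × ((Fin 2 × Bool → ℤˣ) × (Bool × Bool → ℤˣ))) (k : Fin 2) (s : Bool) :
    cfgEquiv.symm y (axis k s) = y.2.1 (k, s) := rfl

/-- Spins of the split configuration: corners. [folklore] -/
@[simp] theorem cfgEquiv_symm_corner (y : Cfg × ((Fin 2 × Bool → ℤˣ) × (Bool × Bool → ℤˣ))) (s s' : Bool) :
    cfgEquiv.symm y (corner s s') = y.2.2 (s, s') := rfl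

/-- `spinAt p σ = sp (σ p)`. [folklore] -/
theorem spinAt_eq_sp (p : V) (σ : SpinConfig V) : spinAt p σ = sp (σ p) := rfl

/-! ### The high-temperature representation and the boundary sums -/

/-- **High-temperature form of the Boltzmann weight of the ball**, split along the three edge families. [cite: FriedliVelenik2017, §3.7.3] -/
theorem weight_eq (J : ℝ) (σ : SpinConfig V) :
    Real.exp (J * ∑ e ∈ graph.edgeFinset, bondSpin σ e) =
      Real.cosh J ^ 16 * ((∏ ks : Fin 2 × Bool, (1 + Real.tanh J * (spinAt centre σ * spinAt (mid ks.1 ks.2) σ))) *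
        (∏ ks : Fin 2 × Bool, (1 + Real.tanh J * (spinAt (mid ks.1 ks.2) σ * spinAt (axis ks.1 ks.2) σ))) *
        ∏ c : Bool × Bool, ((1 + Real.tanh J * (spinAt (corner c.1 c.2) σ * spinAt (mid 0 c.1) σ)) *
          (1 + Real.tanh J * (spinAt (corner c.1 c.2) σ * spinAt (mid 1 c.2) σ)))) := by
  rw [mul_sum, Real.exp_sum]
  have h1 : ∏ e ∈ graph.edgeFinset, Real.exp (J * bondSpin σ e) = ∏ e ∈ graph.edgeFinset, (Real.cosh J * (1 + Real.tanh J * bondSpin σ e)) :=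
    prod_congr rfl fun e _ => exp_mul_sign J (bondSpin_eq_one_or σ e)
  have hcard : graph.edgeFinset.card = 16 := by rw [edgeFinset_graph]; decide
  rw [h1, prod_mul_distrib, prod_const, hcard, prod_edgeFinset_graph]
  simp only [bondSpin_mk]

/-- **Summing out the axis spins**: `∑_{fa} ∏_{ks} (1 + t m_{ks} u_{ks}) = 2⁴`. [folklore] -/
theorem axis_sum (t : ℝ) (m : Fin 2 × Bool → ℝ) :
    ∑ fa : Fin 2 × Bool → ℤˣ, ∏ ks : Fin 2 × Bool, (1 + t * (m ks * sp (fa ks))) = 2 ^ 4 := by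
  rw [← Fintype.prod_sum fun (ks : Fin 2 × Bool) (u : ℤˣ) => 1 + t * (m ks * sp u)]
  have h : ∀ ks : Fin 2 × Bool, ∑ u : ℤˣ, (1 + t * (m ks * sp u)) = 2 := fun ks => by
    rw [sum_units, sp_one, sp_neg_one]; ring
  rw [prod_congr rfl fun ks _ => h ks, prod_const]
  simp

/-- **Summing out the corner spins**: `∑_{fc} ∏_c (1 + t u_c m₀)(1 + t u_c m₁) = 2⁴ ∏_c (1 + t² m₀ m₁)`. [folklore] -/
theorem corner_sum (t : ℝ) (m₁ m₂ : Bool × Bool → ℝ) :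
    ∑ fc : Bool × Bool → ℤˣ, ∏ c : Bool × Bool, ((1 + t * (sp (fc c) * m₁ c)) * (1 + t * (sp (fc c) * m₂ c))) =
      2 ^ 4 * ∏ c : Bool × Bool, (1 + t ^ 2 * m₁ c * m₂ c) := by
  rw [← Fintype.prod_sum fun (c : Bool × Bool) (u : ℤˣ) => (1 + t * (sp u * m₁ c)) * (1 + t * (sp u * m₂ c))]
  have h : ∀ c : Bool × Bool, ∑ u : ℤˣ, (1 + t * (sp u * m₁ c)) * (1 + t * (sp u * m₂ c)) = 2 * (1 + t ^ 2 * m₁ c * m₂ c) :=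
    fun c => by rw [sum_units, sp_one, sp_neg_one]; ring
  rw [prod_congr rfl fun c _ => h c, prod_mul_distrib, prod_const]
  simp

/-- **CORE REDUCTION**: for an observable of the core spins, the Boltzmann sum over all `2¹³` configurations of the ball is `cosh^{16}J · 2^{8}` times
a sum over the `2⁵` core configurations with the polynomial weight `∏_{ks}(1 + t σ_0 m_{ks}) ∏_c (1 + t² m₀(c) m₁(c))`, `t = tanh J`.
[cite: FriedliVelenik2017, §3.7.3] -/
theorem sum_cfg_eq_coreSum (J : ℝ) (F : Cfg → ℝ) :
    ∑ σ : SpinConfig V, F (cfgEquiv σ).1 * Real.exp (J * ∑ e ∈ graph.edgeFinset, bondSpin σ e) =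
      Real.cosh J ^ 16 * 2 ^ 8 * ∑ x : Cfg, F x *
        ((∏ ks : Fin 2 × Bool, (1 + Real.tanh J * (sp x.1 * sp (x.m ks.1 ks.2)))) *
          ∏ c : Bool × Bool, (1 + Real.tanh J ^ 2 * sp (x.m 0 c.1) * sp (x.m 1 c.2))) := by
  set t := Real.tanh J with ht
  simp_rw [weight_eq J, spinAt_eq_sp]
  rw [← cfgEquiv.symm.sum_comp, Fintype.sum_prod_type, mul_sum]
  refine sum_congr rfl fun x _ => ?_
  rw [Fintype.sum_prod_type]
  simp only [Equiv.apply_symm_apply, cfgEquiv_symm_centre, cfgEquiv_symm_mid, cfgEquiv_symm_axis, cfgEquiv_symm_corner]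
  have hA := axis_sum t (fun ks => sp (x.m ks.1 ks.2))
  have hC := corner_sum t (fun c => sp (x.m 0 c.1)) (fun c => sp (x.m 1 c.2))
  calc ∑ fa : Fin 2 × Bool → ℤˣ, ∑ fc : Bool × Bool → ℤˣ, F x * (Real.cosh J ^ 16 *
          ((∏ ks : Fin 2 × Bool, (1 + t * (sp x.1 * sp (x.m ks.1 ks.2)))) *
            (∏ ks : Fin 2 × Bool, (1 + t * (sp (x.m ks.1 ks.2) * sp (fa (ks.1, ks.2))))) *
            ∏ c : Bool × Bool, ((1 + t * (sp (fc (c.1, c.2)) * sp (x.m 0 c.1))) * (1 + t * (sp (fc (c.1, c.2)) * sp (x.m 1 c.2))))))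
        = F x * Real.cosh J ^ 16 * (∏ ks : Fin 2 × Bool, (1 + t * (sp x.1 * sp (x.m ks.1 ks.2)))) *
            ((∑ fa : Fin 2 × Bool → ℤˣ, ∏ ks : Fin 2 × Bool, (1 + t * (sp (x.m ks.1 ks.2) * sp (fa ks)))) *
             ∑ fc : Bool × Bool → ℤˣ, ∏ c : Bool × Bool,
               ((1 + t * (sp (fc c) * sp (x.m 0 c.1))) * (1 + t * (sp (fc c) * sp (x.m 1 c.2))))) := by
          rw [sum_mul_sum]
          rw [mul_sum]
          refine sum_congr rfl fun fa _ => ?_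
          rw [mul_sum]
          refine sum_congr rfl fun fc _ => ?_
          ring
    _ = _ := by rw [hA, hC]; ring

/-! ### The rung-3 coupling `β₃ = artanh(6/19)` and the exact core expectation -/

/-- **The `d = 3` rung-3 coupling** `β₃ = artanh(6/19) = ½ log(25/13) = 0.326962…`. [folklore] -/
def beta3 : ℝ := Real.artanh (6 / 19)

/-- `tanh β₃ = 6/19`. [folklore] -/
theorem tanh_beta3 : Real.tanh beta3 = 6 / 19 := Real.tanh_artanh (by constructor <;> norm_num)

/-- `0 < β₃`. [folklore] -/
theorem beta3_pos : 0 < beta3 := Real.artanh_pos (by constructor <;> norm_num)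

/-- The polynomial core weight at `t = 6/19` is `W(x) / (19⁴ · 361⁴)`. [folklore] -/
theorem coreProd_eq_coreW_div (x : Cfg) :
    (∏ ks : Fin 2 × Bool, (1 + (6 / 19 : ℝ) * (sp x.1 * sp (x.m ks.1 ks.2)))) *
        ∏ c : Bool × Bool, (1 + (6 / 19 : ℝ) ^ 2 * sp (x.m 0 c.1) * sp (x.m 1 c.2)) = coreW x / (19 ^ 4 * 361 ^ 4) := by
  have h1 : ∀ ks : Fin 2 × Bool, (1 + (6 / 19 : ℝ) * (sp x.1 * sp (x.m ks.1 ks.2))) = (19 + 6 * sp x.1 * sp (x.m ks.1 ks.2)) / 19 :=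
    fun ks => by ring
  have h2 : ∀ c : Bool × Bool, (1 + (6 / 19 : ℝ) ^ 2 * sp (x.m 0 c.1) * sp (x.m 1 c.2)) = (361 + 36 * sp (x.m 0 c.1) * sp (x.m 1 c.2)) / 361 :=
    fun c => by ring
  simp only [h1, h2, prod_div_distrib, prod_const, card_univ, Fintype.card_prod, Fintype.card_fin, Fintype.card_bool, coreW]
  norm_num
  ring

/-- **EXACT CORE EXPECTATIONS AT `β₃`**: `⟨F⟩^∅_{B₂;β₃} = (∑_x F(x) W(x)) / ∑_x W(x)` (sums over the `32` core configurations).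
[cite: FriedliVelenik2017, §3.7.3] -/
theorem isingExpect_core_eq (F : Cfg → ℝ) :
    isingExpect graph univ beta3 0 .free (fun σ => F (cfgEquiv σ).1) = (∑ x : Cfg, F x * coreW x) / ∑ x : Cfg, coreW x := by
  rw [PairIsing.isingExpect_univ_free_eq_sum_div, sum_cfg_eq_coreSum beta3 F]
  have hden := sum_cfg_eq_coreSum beta3 (fun _ => (1 : ℝ))
  simp only [one_mul] at hden
  rw [hden, tanh_beta3]
  simp only [coreProd_eq_coreW_div]
  have hK : (0 : ℝ) < Real.cosh beta3 ^ 16 * 2 ^ 8 := by positivity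
  rw [mul_div_mul_left _ _ hK.ne']
  simp only [mul_div_assoc', ← sum_div]
  rw [div_div_div_cancel_right₀ (by norm_num)]

/-- The core tuple of a configuration reads the middle spins. [folklore] -/
theorem cfgEquiv_fst_m (σ : SpinConfig V) (k : Fin 2) (s : Bool) : (cfgEquiv σ).1.m k s = σ (mid k s) := by
  fin_cases k <;> cases s <;> rfl

/-- The core tuple of a configuration reads the centre spin. [folklore] -/
theorem cfgEquiv_fst_fst (σ : SpinConfig V) : (cfgEquiv σ).1.1 = σ centre := rfl

/-- **THE EXACT CORE NUMBER OF RUNG 3 (`d = 3`)**: `∑_{k,s} ⟨σ_0 σ_{mid k s}⟩^∅_{B₂; artanh(6/19)} = 111425521874979072 / 73973434400755232 = 1.5062911…`.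
[folklore] -/
theorem sum_isingTwoPoint_centre_mid_eq :
    ∑ ks : Fin 2 × Bool, isingTwoPoint graph univ beta3 0 .free centre (mid ks.1 ks.2) = 111425521874979072 / 73973434400755232 := by
  have hobs : (fun σ : SpinConfig V => ∑ ks : Fin 2 × Bool, spinPair centre (mid ks.1 ks.2) σ) = fun σ => coreObs (cfgEquiv σ).1 := by
    funext σ
    simp only [coreObs, spinPair, spinAt_eq_sp, cfgEquiv_fst_m, cfgEquiv_fst_fst, mul_sum]
  have hsum := isingExpect_finset_sum' graph univ 0 BoundaryCondition.free beta3 (univ : Finset (Fin 2 × Bool))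
    (fun ks σ => spinPair centre (mid ks.1 ks.2) σ) (fun ks => measurable_spinPair centre (mid ks.1 ks.2))
  unfold isingTwoPoint
  rw [hobs, isingExpect_core_eq coreObs, coreSum_obs, coreSum_one] at hsum
  exact hsum.symm

end BallD3

end Summit.Ventures.YMGap.RobustBall

end
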